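import Mathlib.MeasureTheory.Integral.MeanInequalities
import Mathlib.MeasureTheory.Integral.Lebesgue.Add
import Mathlib.MeasureTheory.Group.LIntegral
import Mathlib.Analysis.LConvolution
import Mathlib.Analysis.InnerProductSpace.PiL2
import Mathlib.MeasureTheory.Measure.Haar.Unique
import HarnessLib

/-!
# The scalar majorant ("cheap Navier–Stokes") equation of the Fujita–Kato scheme

Second layer of the discharge programme for the named fact `Literature.Analysis.FluidPDE.fujita_kato_local`
(`Literature/Analysis/FluidPDE/MildSolutions.lean`; source: Lemarié-Rieusset, *The Navier–Stokes
problem in the 21st century*, 2nd ed., §8.8 "Cheap Navier–Stokes equation", PDF pp. 207–210 of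
the held copy; first layer: `Literature/Analysis/FluidPDE/FujitaKatoHeatWeights.lean`). The
Picard iterates `U^{[n]}` of the Fourier-transformed
Navier–Stokes system are dominated pointwise by the iterates of a *scalar* quadratic equation for
nonnegative envelopes on frequency space; with the time weight `t^{1/4}` of the Fujita–Kato
class that equation is the inequation (PDF p. 209)

  `M₀(ξ) + C |ξ|^{-1/2} (M₁ ∗ M₁)(ξ) ≤ M₁(ξ)`

in the lattice `F = L²(|ξ|² dξ) = 𝓕Ḣ¹`. This file solves it by monotone iteration, entirely in
`ℝ≥0∞`-valued functions (no integrability side conditions), on a general finite-dimensional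
inner product space `E`, *assuming* the one harmonic-analysis input as a hypothesis
`HasProductLaw E K`: `‖ |ξ|^{-1/2}(A ⋆ B) ‖_F ≤ K ‖A‖_F ‖B‖_F` (in dimension three this is
`Literature.Analysis.FunctionSpaces.FourierProductLaw.lintegral_enorm_mul_lconv_sq_le`, file
`Literature/Analysis/FunctionSpaces/SobolevProductLawFourier.lean`, with `K² = 48 |B(0,1)|`).

## Contents (all PROVED)

* `lconv A B ξ = ∫⁻ A(ξ-η) B(η) dη`, monotone, measurable, and continuous along monotone
  sequences (`lconv_iSup`, monotone convergence);
* `fnorm A = (∫⁻ (‖ξ‖ A)²)^{1/2} = ‖A‖_F` with Minkowski (`fnorm_add_le`), homogeneity,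
  monotone convergence (`fnorm_iSup`) and countable subadditivity (`fnorm_tsum_le`);
* `weight ξ = ‖ξ‖^{-1/2}`, `HasProductLaw`, and the bilinear bound `fnorm_weight_mul_lconv_le`;
* the majorant map `majMap κ M₀ M = M₀ + κ w (M ⋆ M)`, its iterates `majIter`, and the minimal
  solution `majorant κ M₀ = ⨆ₙ majIter n`: `majorant = majMap κ M₀ majorant` (`majorant_eq`),
  minimality `majMap κ M₀ N ≤ N → majorant κ M₀ ≤ N` (`majorant_le_of_majMap_le`, the printed
  comparison `W^{[n]} ≤ W` with a supersolution, PDF p. 207), and `‖majorant‖_F ≤ 2 ‖M₀‖_F`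
  whenever `4 κ K ‖M₀‖_F ≤ 1` (`fnorm_majorant_le`; the ball of radius `2‖M₀‖_F` is invariant);
* the difference majorants `diffIter κ M E₀` (`E⁽ⁿ⁺¹⁾ = κ w (E⁽ⁿ⁾ ⋆ M + M ⋆ E⁽ⁿ⁾)`) with
  geometric decay `‖E⁽ⁿ⁾‖_F ≤ 2⁻ⁿ ‖E₀‖_F` under `2 κ K ‖M‖_F ≤ 1/2` and `‖∑ E⁽ⁿ⁾‖_F ≤ 2‖E₀‖_F`;
* a.e. finiteness of envelopes with finite `‖·‖_F` (positive dimension).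

**Chaining the two smallness conditions.** `fnorm_majorant_le` needs `4 κ K ‖M₀‖_F ≤ 1` and
yields `‖M‖_F ≤ 2‖M₀‖_F`, hence only `2 κ K ‖M‖_F ≤ 1`; the contraction hypothesis of
`fnorm_diffIter_le` with `M = majorant κ M₀` is `2 κ K ‖M‖_F ≤ 1/2`. Both hold under the single
condition `8 κ K ‖M₀‖_F ≤ 1` (`contraction_of_small`), which is what the next layer (the
dominated vector Picard iteration) assumes.

## Mathlib search

Mathlib has the Lebesgue-integral convolution of `ℝ≥0∞`-valued functions,
`MeasureTheory.lconvolution` (`Mathlib/Analysis/LConvolution.lean`, notation `f ⋆ₗ g`,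
`(f ⋆ₗ g) x = ∫⁻ y, f y * g (-y + x)`, with `measurable_lconvolution`, `lconvolution_comm`); the
envelope convolution `lconv A B ξ = ∫⁻ η, A (ξ - η) * B η` used here (the unfolding shape of the
product law `Literature.Analysis.FunctionSpaces.FourierProductLaw.lintegral_enorm_mul_lconv_sq_le`) *is* `B ⋆ₗ A`
(`lconv_eq_lconvolution`), and measurability is imported from there. No weighted-`L²` lattice
fixed points in Mathlib. Also used: `ENNReal.lintegral_Lp_add_le` (Minkowski), `lintegral_iSup`
(monotone convergence), `ENNReal.orderIsoRpow` (`rpow` commutes with `⨆`),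
`ENNReal.tsum_geometric`, `ae_lt_top'`.

## References

* P. G. Lemarié-Rieusset, *The Navier–Stokes problem in the 21st century*, second edition,
  Chapman & Hall/CRC (doi:10.1201/9781003042594), §8.8, PDF pp. 207–210 of the held copy
  `book:lemarie-rieusset2016-navier-stokes-problem-21st-century` (catalogued under the 2016 first
  edition, doi:10.1201/b19556; its front matter, PDF p. 2–3, carries the second-edition DOI and a
  "Preface to the Second Edition"; all locators below are PDF pages of that copy).
  [Lemarierieusset2023]
-/

noncomputable section

open MeasureTheory Set Filter Topology
open scoped ENNReal NNReal

namespace Literature.Analysis.FluidPDE.FujitaKato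

variable {E : Type*} [NormedAddCommGroup E] [InnerProductSpace ℝ E] [FiniteDimensional ℝ E]
  [MeasurableSpace E] [BorelSpace E]

/-! ### Convolution of envelopes -/

/-- The convolution `(A ⋆ B)(ξ) = ∫⁻ A(ξ - η) B(η) dη` of two `ℝ≥0∞`-valued envelopes on
frequency space (Lemarié-Rieusset, §8.8: the majorant nonlinearity `Z ∗ V`, PDF p. 208); this is
Mathlib's `B ⋆ₗ A` (`lconv_eq_lconvolution`), kept as a named two-argument function because the
unfolded shape `∫⁻ η, A (ξ - η) * B η` is the one of the product law
`Literature.Analysis.FunctionSpaces.FourierProductLaw.lintegral_enorm_mul_lconv_sq_le`. [cite: Lemarierieusset2023, §8.8 (PDF p. 208)] -/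
def lconv (A B : E → ℝ≥0∞) (ξ : E) : ℝ≥0∞ :=
  ∫⁻ η, A (ξ - η) * B η

/-- Unfolding `lconv`. [folklore] -/
theorem lconv_apply (A B : E → ℝ≥0∞) (ξ : E) : lconv A B ξ = ∫⁻ η, A (ξ - η) * B η := rfl

/-- `lconv A B` is Mathlib's Lebesgue convolution `B ⋆ₗ A`
(`MeasureTheory.lconvolution`, `(f ⋆ₗ g) x = ∫⁻ y, f y * g (-y + x)`). [folklore] -/
theorem lconv_eq_lconvolution (A B : E → ℝ≥0∞) : lconv A B = B ⋆ₗ A := by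
  funext ξ
  simp only [lconv, lconvolution_def, neg_add_eq_sub, mul_comm]

/-- The convolution of measurable envelopes is measurable (Mathlib
`MeasureTheory.measurable_lconvolution`). [folklore] -/
theorem measurable_lconv {A B : E → ℝ≥0∞} (hA : Measurable A) (hB : Measurable B) :
    Measurable (lconv A B) := by
  rw [lconv_eq_lconvolution]
  exact measurable_lconvolution volume hB hA

/-- `lconv` is monotone in both arguments. [folklore] -/
theorem lconv_mono {A A' B B' : E → ℝ≥0∞} (hA : A ≤ A') (hB : B ≤ B') :
    lconv A B ≤ lconv A' B' := fun _ =>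
  lintegral_mono fun _ => mul_le_mul' (hA _) (hB _)

/-- For monotone families in `ℝ≥0∞`, `(⨆ f) * (⨆ g) = ⨆ n, f n * g n`. [folklore] -/
theorem iSup_mul_iSup_of_monotone {f g : ℕ → ℝ≥0∞} (hf : Monotone f) (hg : Monotone g) :
    (⨆ n, f n) * (⨆ n, g n) = ⨆ n, f n * g n := by
  refine le_antisymm ?_ (iSup_le fun n => mul_le_mul' (le_iSup f n) (le_iSup g n))
  rw [ENNReal.iSup_mul]
  refine iSup_le fun i => ?_
  rw [ENNReal.mul_iSup]
  refine iSup_le fun j => ?_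
  exact (mul_le_mul' (hf (le_max_left i j)) (hg (le_max_right i j))).trans
    (le_iSup (fun n => f n * g n) (max i j))

/-- **Monotone convergence inside the convolution**: for a monotone sequence of measurable
envelopes, `(⨆ Aₙ) ⋆ (⨆ Aₙ) = ⨆ (Aₙ ⋆ Aₙ)`. [folklore] -/
theorem lconv_iSup {A : ℕ → E → ℝ≥0∞} (hA : ∀ n, Measurable (A n)) (hmono : Monotone A)
    (ξ : E) : lconv (fun η => ⨆ n, A n η) (fun η => ⨆ n, A n η) ξ = ⨆ n, lconv (A n) (A n) ξ := by
  simp only [lconv]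
  have h1 : ∀ η, (⨆ n, A n (ξ - η)) * (⨆ n, A n η) = ⨆ n, A n (ξ - η) * A n η := fun η =>
    iSup_mul_iSup_of_monotone (fun i j hij => hmono hij _) (fun i j hij => hmono hij _)
  simp_rw [h1]
  refine lintegral_iSup (fun n => ?_) (fun i j hij η => ?_)
  · exact ((hA n).comp (measurable_const.sub measurable_id)).mul (hA n)
  · exact mul_le_mul' (hmono hij _) (hmono hij _)

/-! ### The `𝓕Ḣ¹` norm of an envelope -/

/-- The `𝓕Ḣ¹`-norm `‖A‖_F = (∫⁻ (‖ξ‖ A(ξ))² dξ)^{1/2}` of an envelope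
(Lemarié-Rieusset, 2nd ed., §8.8: `F = L²(|ξ|² dξ)`). [cite: Lemarierieusset2023, §8.8 (PDF p. 209)] -/
def fnorm (A : E → ℝ≥0∞) : ℝ≥0∞ :=
  (∫⁻ ξ, (‖ξ‖ₑ * A ξ) ^ (2 : ℝ)) ^ (1 / 2 : ℝ)

/-- `‖A‖_F² = ∫⁻ ‖ξ‖² A²`. [folklore] -/
theorem fnorm_sq (A : E → ℝ≥0∞) : fnorm A ^ 2 = ∫⁻ ξ, ‖ξ‖ₑ ^ 2 * A ξ ^ 2 := by
  rw [fnorm, ← ENNReal.rpow_natCast, ← ENNReal.rpow_mul]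
  norm_num
  refine lintegral_congr fun ξ => ?_
  rw [mul_pow]

/-- `‖A‖_F = (∫⁻ ‖ξ‖² A²)^{1/2}`. [folklore] -/
theorem fnorm_eq_sqrt (A : E → ℝ≥0∞) : fnorm A = (∫⁻ ξ, ‖ξ‖ₑ ^ 2 * A ξ ^ 2) ^ (1 / 2 : ℝ) := by
  rw [← fnorm_sq, ← ENNReal.rpow_natCast, ← ENNReal.rpow_mul]
  norm_num

/-- `‖·‖_F` is monotone. [folklore] -/
theorem fnorm_mono {A B : E → ℝ≥0∞} (h : A ≤ B) : fnorm A ≤ fnorm B := by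
  unfold fnorm
  gcongr
  exact h _

/-- **Minkowski** for `‖·‖_F`. [folklore] -/
theorem fnorm_add_le {A B : E → ℝ≥0∞} (hA : Measurable A) (hB : Measurable B) :
    fnorm (A + B) ≤ fnorm A + fnorm B := by
  have h := ENNReal.lintegral_Lp_add_le (μ := (volume : Measure E)) (p := 2)
    (f := fun ξ => ‖ξ‖ₑ * A ξ) (g := fun ξ => ‖ξ‖ₑ * B ξ)
    (measurable_id.enorm.mul hA).aemeasurable (measurable_id.enorm.mul hB).aemeasurable
    one_le_two
  unfold fnorm
  convert h using 4 with ξ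
  simp [mul_add]

/-- Homogeneity: `‖c A‖_F = c ‖A‖_F` for `c ≠ ∞`. [folklore] -/
theorem fnorm_const_mul {c : ℝ≥0∞} (hc : c ≠ ∞) (A : E → ℝ≥0∞) :
    fnorm (fun ξ => c * A ξ) = c * fnorm A := by
  unfold fnorm
  have h : ∀ ξ, (‖ξ‖ₑ * (c * A ξ)) ^ (2 : ℝ) = c ^ (2 : ℝ) * (‖ξ‖ₑ * A ξ) ^ (2 : ℝ) := fun ξ => by
    rw [← ENNReal.mul_rpow_of_nonneg _ _ (by norm_num : (0 : ℝ) ≤ 2)]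
    ring_nf
  simp_rw [h]
  rw [lintegral_const_mul' _ _ (ENNReal.rpow_ne_top_of_nonneg (by norm_num) hc),
    ENNReal.mul_rpow_of_nonneg _ _ (by norm_num : (0 : ℝ) ≤ 1 / 2), ← ENNReal.rpow_mul]
  norm_num

/-- `x ↦ x ^ y` (`y > 0`) commutes with suprema in `ℝ≥0∞`. [folklore] -/
theorem iSup_rpow {ι : Sort*} (f : ι → ℝ≥0∞) {y : ℝ} (hy : 0 < y) :
    (⨆ i, f i) ^ y = ⨆ i, f i ^ y :=
  (ENNReal.orderIsoRpow y hy).map_iSup f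

/-- **Monotone convergence for `‖·‖_F`.** [folklore] -/
theorem fnorm_iSup {A : ℕ → E → ℝ≥0∞} (hA : ∀ n, Measurable (A n)) (hmono : Monotone A) :
    fnorm (fun ξ => ⨆ n, A n ξ) = ⨆ n, fnorm (A n) := by
  unfold fnorm
  have h1 : ∀ ξ, (‖ξ‖ₑ * ⨆ n, A n ξ) ^ (2 : ℝ) = ⨆ n, (‖ξ‖ₑ * A n ξ) ^ (2 : ℝ) := by
    intro ξ
    rw [ENNReal.mul_iSup, iSup_rpow _ (by norm_num : (0 : ℝ) < 2)]
  simp_rw [h1]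
  rw [lintegral_iSup (f := fun n ξ => (‖ξ‖ₑ * A n ξ) ^ (2 : ℝ))
    (fun n => (measurable_id.enorm.mul (hA n)).pow_const _)
    (fun i j hij ξ => by
      dsimp only
      gcongr
      exact hmono hij ξ),
    iSup_rpow _ (by norm_num : (0 : ℝ) < 1 / 2)]

/-- `‖·‖_F` of a finite sum is at most the sum of the norms. [folklore] -/
theorem fnorm_finset_sum_le {A : ℕ → E → ℝ≥0∞} (hA : ∀ n, Measurable (A n)) (N : ℕ) :
    fnorm (fun ξ => ∑ n ∈ Finset.range N, A n ξ) ≤ ∑ n ∈ Finset.range N, fnorm (A n) := by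
  induction N with
  | zero => simp [fnorm]
  | succ N ih =>
    simp_rw [Finset.sum_range_succ]
    calc fnorm (fun ξ => ∑ n ∈ Finset.range N, A n ξ + A N ξ)
        ≤ fnorm (fun ξ => ∑ n ∈ Finset.range N, A n ξ) + fnorm (A N) :=
          fnorm_add_le (Finset.measurable_sum _ fun n _ => hA n) (hA N)
      _ ≤ _ := add_le_add ih le_rfl

/-- **Countable subadditivity of `‖·‖_F`** (Minkowski and monotone convergence). [folklore] -/
theorem fnorm_tsum_le {A : ℕ → E → ℝ≥0∞} (hA : ∀ n, Measurable (A n)) :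
    fnorm (fun ξ => ∑' n, A n ξ) ≤ ∑' n, fnorm (A n) := by
  have h1 : (fun ξ => ∑' n, A n ξ) = fun ξ => ⨆ N, ∑ n ∈ Finset.range N, A n ξ := by
    funext ξ
    exact ENNReal.tsum_eq_iSup_nat
  rw [h1, fnorm_iSup (fun N => Finset.measurable_sum _ fun n _ => hA n)
    (fun i j hij ξ => Finset.sum_le_sum_of_subset (Finset.range_mono hij)), ENNReal.tsum_eq_iSup_nat]
  exact iSup_mono fun N => fnorm_finset_sum_le hA N

/-! ### The weight `|ξ|^{-1/2}` and the product-law hypothesis -/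

/-- The weight `w(ξ) = ‖ξ‖^{-1/2}` (`= ∞` at `ξ = 0`). [folklore] -/
def weight (ξ : E) : ℝ≥0∞ := (‖ξ‖ₑ ^ (1 / 2 : ℝ))⁻¹

omit [InnerProductSpace ℝ E] [FiniteDimensional ℝ E] in
/-- The weight is measurable. [folklore] -/
theorem measurable_weight : Measurable (weight (E := E)) :=
  (measurable_id.enorm.pow_const _).inv

omit [InnerProductSpace ℝ E] [FiniteDimensional ℝ E] [MeasurableSpace E] [BorelSpace E] in
/-- `‖ξ‖² w(ξ)² = ‖ξ‖`. [folklore] -/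
theorem enorm_sq_mul_weight_sq (ξ : E) : ‖ξ‖ₑ ^ 2 * weight ξ ^ 2 = ‖ξ‖ₑ := by
  rcases eq_or_ne ‖ξ‖ₑ 0 with h | h
  · simp [h]
  · rw [weight, ← ENNReal.rpow_natCast, ← ENNReal.rpow_natCast, ENNReal.inv_rpow,
      ← ENNReal.rpow_mul]
    norm_num
    rw [sq, mul_assoc, ENNReal.mul_inv_cancel h enorm_ne_top, mul_one]

variable (E) in
/-- **The product-law hypothesis** with constant `K`: for all measurable envelopes,
`∫⁻ ‖ξ‖ (A ⋆ B)² ≤ K² ‖A‖_F² ‖B‖_F²` — i.e. `‖ |ξ|^{-1/2} (A ⋆ B) ‖_F ≤ K ‖A‖_F ‖B‖_F`, the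
boundedness of `(Z, V) ↦ |ξ|^{-1/2}(Z ∗ V)` on `F` (Lemarié-Rieusset, 2nd ed., §8.8, PDF p. 209). In
dimension three it holds with `K² = 48 |B(0,1)|`
(`Literature.Analysis.FunctionSpaces.FourierProductLaw.lintegral_enorm_mul_lconv_sq_le`). [cite: Lemarierieusset2023, §8.8 (PDF p. 209)] -/
def HasProductLaw (K : ℝ≥0∞) : Prop :=
  ∀ A B : E → ℝ≥0∞, Measurable A → Measurable B →
    ∫⁻ ξ, ‖ξ‖ₑ * (lconv A B ξ) ^ 2 ≤ K ^ 2 * (∫⁻ ξ, ‖ξ‖ₑ ^ 2 * A ξ ^ 2) * ∫⁻ ξ, ‖ξ‖ₑ ^ 2 * B ξ ^ 2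

/-- **The bilinear estimate in `F`**: `‖ w · (A ⋆ B) ‖_F ≤ K ‖A‖_F ‖B‖_F`. [cite: Lemarierieusset2023, §8.8 (PDF p. 209)] -/
theorem fnorm_weight_mul_lconv_le {K : ℝ≥0∞} (hK : HasProductLaw E K) {A B : E → ℝ≥0∞}
    (hA : Measurable A) (hB : Measurable B) :
    fnorm (fun ξ => weight ξ * lconv A B ξ) ≤ K * fnorm A * fnorm B := by
  have h1 : fnorm (fun ξ => weight ξ * lconv A B ξ) ^ 2 ≤ (K * fnorm A * fnorm B) ^ 2 := by
    rw [fnorm_sq, mul_pow, mul_pow, fnorm_sq, fnorm_sq]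
    calc ∫⁻ ξ, ‖ξ‖ₑ ^ 2 * (weight ξ * lconv A B ξ) ^ 2
        = ∫⁻ ξ, ‖ξ‖ₑ * lconv A B ξ ^ 2 := by
          refine lintegral_congr fun ξ => ?_
          rw [mul_pow, ← mul_assoc, enorm_sq_mul_weight_sq]
      _ ≤ _ := hK A B hA hB
  exact (ENNReal.pow_le_pow_left_iff two_ne_zero).1 h1

/-! ### The majorant map and its minimal fixed point -/

/-- The majorant map `T(M) = M₀ + κ w · (M ⋆ M)` (Lemarié-Rieusset, 2nd ed., §8.8, (8.14)/(8.15)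
and the inequation `M₀ + C |ξ|^{-1/2} (M₁ ∗ M₁) ≤ M₁` of PDF p. 209). [cite: Lemarierieusset2023, §8.8 (PDF p. 209)] -/
def majMap (κ : ℝ≥0∞) (M₀ M : E → ℝ≥0∞) (ξ : E) : ℝ≥0∞ :=
  M₀ ξ + κ * weight ξ * lconv M M ξ

/-- The monotone iteration `M⁽⁰⁾ = M₀`, `M⁽ⁿ⁺¹⁾ = T(M⁽ⁿ⁾)`. [cite: Lemarierieusset2023, §8.8 (PDF p. 208)] -/
def majIter (κ : ℝ≥0∞) (M₀ : E → ℝ≥0∞) : ℕ → E → ℝ≥0∞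
  | 0 => M₀
  | n + 1 => majMap κ M₀ (majIter κ M₀ n)

/-- The majorant `M = ⨆ₙ M⁽ⁿ⁾`, the minimal solution of `M = M₀ + κ w · (M ⋆ M)`. [cite: Lemarierieusset2023, §8.8 (PDF p. 208)] -/
def majorant (κ : ℝ≥0∞) (M₀ : E → ℝ≥0∞) (ξ : E) : ℝ≥0∞ :=
  ⨆ n, majIter κ M₀ n ξ

variable {κ : ℝ≥0∞} {M₀ : E → ℝ≥0∞}

/-- The majorant map is monotone. [folklore] -/
theorem majMap_mono {M M' : E → ℝ≥0∞} (h : M ≤ M') : majMap κ M₀ M ≤ majMap κ M₀ M' :=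
  fun ξ => by
    unfold majMap
    gcongr
    exact lconv_mono h h ξ

/-- `M₀ ≤ T(M)`. [folklore] -/
theorem le_majMap (M : E → ℝ≥0∞) : M₀ ≤ majMap κ M₀ M := fun _ => le_self_add

/-- The majorant map preserves measurability. [folklore] -/
theorem measurable_majMap (hM₀ : Measurable M₀) {M : E → ℝ≥0∞} (hM : Measurable M) :
    Measurable (majMap κ M₀ M) :=
  hM₀.add ((measurable_const.mul measurable_weight).mul (measurable_lconv hM hM))

/-- The iterates are measurable. [folklore] -/
theorem measurable_majIter (hM₀ : Measurable M₀) : ∀ n, Measurable (majIter κ M₀ n)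
  | 0 => hM₀
  | n + 1 => measurable_majMap hM₀ (measurable_majIter hM₀ n)

/-- The iteration is monotone. [folklore] -/
theorem majIter_mono : Monotone (majIter κ M₀) := by
  refine monotone_nat_of_le_succ fun n => ?_
  induction n with
  | zero => exact le_majMap _
  | succ n ih => exact majMap_mono ih

/-- The majorant is measurable. [folklore] -/
theorem measurable_majorant (hM₀ : Measurable M₀) : Measurable (majorant κ M₀) :=
  Measurable.iSup (measurable_majIter hM₀)

/-- `M₀ ≤ M`. [folklore] -/
theorem le_majorant : M₀ ≤ majorant κ M₀ := fun ξ => le_iSup (fun n => majIter κ M₀ n ξ) 0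

/-- Each iterate is below the majorant. [folklore] -/
theorem majIter_le_majorant (n : ℕ) : majIter κ M₀ n ≤ majorant κ M₀ := fun ξ =>
  le_iSup (fun n => majIter κ M₀ n ξ) n

/-- Every iterate lies below any supersolution `N` of the cheap equation (`T(N) ≤ N`)
(Lemarié-Rieusset, §8.8, PDF p. 207: "by induction on `n` … `W^{[n]} ≤ W^{[n+1]} ≤ W`"). [cite: Lemarierieusset2023, §8.8 (PDF p. 207)] -/
theorem majIter_le_of_majMap_le {N : E → ℝ≥0∞} (hN : majMap κ M₀ N ≤ N) :
    ∀ n, majIter κ M₀ n ≤ N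
  | 0 => (le_majMap N).trans hN
  | n + 1 => (majMap_mono (majIter_le_of_majMap_le hN n)).trans hN

/-- **Minimality of the majorant**: `majorant κ M₀` is the least supersolution of
`M = M₀ + κ w · (M ⋆ M)` — if `majMap κ M₀ N ≤ N` then `majorant κ M₀ ≤ N`
(Lemarié-Rieusset, §8.8, PDF p. 207: `W^{[∞]} ≤ W`). [cite: Lemarierieusset2023, §8.8 (PDF p. 207)] -/
theorem majorant_le_of_majMap_le {N : E → ℝ≥0∞} (hN : majMap κ M₀ N ≤ N) :
    majorant κ M₀ ≤ N := fun ξ =>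
  iSup_le fun n => majIter_le_of_majMap_le hN n ξ

/-- **The majorant solves the cheap equation**: `M = M₀ + κ w · (M ⋆ M)` (monotone convergence;
Lemarié-Rieusset, 2nd ed., §8.8, PDF p. 208: "By monotonous convergence, we have
`Z^{[∞]} = Z^{[0]} + B₀(Z^{[∞]}, Z^{[∞]})`"). [cite: Lemarierieusset2023, §8.8 (PDF p. 208)] -/
theorem majorant_eq (hM₀ : Measurable M₀) : majorant κ M₀ = majMap κ M₀ (majorant κ M₀) := by
  funext ξ
  have h1 : lconv (majorant κ M₀) (majorant κ M₀) ξ = ⨆ n, lconv (majIter κ M₀ n) (majIter κ M₀ n) ξ :=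
    lconv_iSup (measurable_majIter hM₀) majIter_mono ξ
  rw [majMap, h1, ENNReal.mul_iSup, ENNReal.add_iSup]
  refine le_antisymm (iSup_le fun n => ?_) (iSup_le fun n => ?_)
  · rcases n with _ | n
    · exact (le_majMap (M₀ := M₀) (κ := κ) (majIter κ M₀ 0) ξ).trans
        (le_iSup (fun n => M₀ ξ + κ * weight ξ * lconv (majIter κ M₀ n) (majIter κ M₀ n) ξ) 0)
    · exact le_iSup (fun n => M₀ ξ + κ * weight ξ * lconv (majIter κ M₀ n) (majIter κ M₀ n) ξ) n
  · exact le_iSup (fun n => majIter κ M₀ n ξ) (n + 1)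

/-- **Norm bound along the iteration**: if `4 κ K ‖M₀‖_F ≤ 1` then `‖M⁽ⁿ⁾‖_F ≤ 2 ‖M₀‖_F`
(the contraction bookkeeping of Lemarié-Rieusset, 2nd ed., §8.8, PDF p. 209, "if `‖M₀‖_E` is small
enough": the quadratic map `T` maps the order interval of envelopes with `‖·‖_F ≤ 2‖M₀‖_F` into
itself). [cite: Lemarierieusset2023, §8.8 (PDF p. 209)] -/
theorem fnorm_majIter_le {K : ℝ≥0∞} (hK : HasProductLaw E K) (hM₀ : Measurable M₀)
    (hκ : κ ≠ ∞) (hsmall : 4 * κ * K * fnorm M₀ ≤ 1) :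
    ∀ n, fnorm (majIter κ M₀ n) ≤ 2 * fnorm M₀
  | 0 => by
    change fnorm M₀ ≤ 2 * fnorm M₀
    calc fnorm M₀ = 1 * fnorm M₀ := (one_mul _).symm
      _ ≤ 2 * fnorm M₀ := by gcongr; norm_num
  | n + 1 => by
    have ih := fnorm_majIter_le hK hM₀ hκ hsmall n
    have hm := measurable_majIter (κ := κ) hM₀ n
    change fnorm (majMap κ M₀ (majIter κ M₀ n)) ≤ 2 * fnorm M₀
    set G : E → ℝ≥0∞ := fun ξ => κ * (weight ξ * lconv (majIter κ M₀ n) (majIter κ M₀ n) ξ)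
      with hGdef
    have hG : Measurable G :=
      measurable_const.mul (measurable_weight.mul (measurable_lconv hm hm))
    have hsplit : majMap κ M₀ (majIter κ M₀ n) = M₀ + G := by
      funext ξ
      simp only [majMap, hGdef, Pi.add_apply, mul_assoc]
    calc fnorm (majMap κ M₀ (majIter κ M₀ n))
        ≤ fnorm M₀ + fnorm G := by rw [hsplit]; exact fnorm_add_le hM₀ hG
      _ = fnorm M₀ + κ * fnorm (fun ξ => weight ξ * lconv (majIter κ M₀ n) (majIter κ M₀ n) ξ) := by
          rw [hGdef, fnorm_const_mul hκ]
      _ ≤ fnorm M₀ + κ * (K * fnorm (majIter κ M₀ n) * fnorm (majIter κ M₀ n)) := by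
          gcongr
          exact fnorm_weight_mul_lconv_le hK hm hm
      _ ≤ fnorm M₀ + κ * (K * (2 * fnorm M₀) * (2 * fnorm M₀)) := by gcongr
      _ = fnorm M₀ + (4 * κ * K * fnorm M₀) * fnorm M₀ := by ring
      _ ≤ fnorm M₀ + 1 * fnorm M₀ := by gcongr
      _ = 2 * fnorm M₀ := by ring

/-- **Norm bound for the majorant**: `‖M‖_F ≤ 2 ‖M₀‖_F` under `4 κ K ‖M₀‖_F ≤ 1`. [cite: Lemarierieusset2023, §8.8 (PDF p. 209)] -/
theorem fnorm_majorant_le {K : ℝ≥0∞} (hK : HasProductLaw E K) (hM₀ : Measurable M₀)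
    (hκ : κ ≠ ∞) (hsmall : 4 * κ * K * fnorm M₀ ≤ 1) :
    fnorm (majorant κ M₀) ≤ 2 * fnorm M₀ := by
  rw [show majorant κ M₀ = fun ξ => ⨆ n, majIter κ M₀ n ξ from rfl,
    fnorm_iSup (measurable_majIter hM₀) majIter_mono]
  exact iSup_le (fnorm_majIter_le hK hM₀ hκ hsmall)

/-- **One smallness condition for both layers**: if `8 κ K ‖M₀‖_F ≤ 1` then
`‖M‖_F ≤ 2 ‖M₀‖_F` and the contraction hypothesis `2 κ K ‖M‖_F ≤ 1/2` of `fnorm_diffIter_le`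
holds for `M = majorant κ M₀`. [cite: Lemarierieusset2023, §8.8 (PDF p. 209)] -/
theorem contraction_of_small {K : ℝ≥0∞} (hK : HasProductLaw E K) (hM₀ : Measurable M₀)
    (hκ : κ ≠ ∞) (hsmall : 8 * κ * K * fnorm M₀ ≤ 1) :
    fnorm (majorant κ M₀) ≤ 2 * fnorm M₀ ∧ 2 * κ * K * fnorm (majorant κ M₀) ≤ 2⁻¹ := by
  have h4 : 4 * κ * K * fnorm M₀ ≤ 1 :=
    le_trans (by gcongr; norm_num) hsmall
  have hM := fnorm_majorant_le hK hM₀ hκ h4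
  refine ⟨hM, ?_⟩
  have h2 : (2 : ℝ≥0∞) * 2⁻¹ = 1 := ENNReal.mul_inv_cancel two_ne_zero ENNReal.ofNat_ne_top
  calc 2 * κ * K * fnorm (majorant κ M₀)
      ≤ 2 * κ * K * (2 * fnorm M₀) := by gcongr
    _ = 4 * κ * K * fnorm M₀ := by ring
    _ = 4 * κ * K * fnorm M₀ * (2 * 2⁻¹) := by rw [h2, mul_one]
    _ = (8 * κ * K * fnorm M₀) * 2⁻¹ := by ring
    _ ≤ 1 * 2⁻¹ := by gcongr
    _ = 2⁻¹ := one_mul _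

/-- Where the majorant is finite, so is its self-convolution (for `ξ ≠ 0`, `κ ≠ 0`): from
`κ w(ξ) (M ⋆ M)(ξ) ≤ M(ξ)`. [folklore] -/
theorem lconv_majorant_lt_top (hM₀ : Measurable M₀) (hκ : κ ≠ 0) {ξ : E}
    (hfin : majorant κ M₀ ξ < ∞) : lconv (majorant κ M₀) (majorant κ M₀) ξ < ∞ := by
  have h1 : κ * weight ξ * lconv (majorant κ M₀) (majorant κ M₀) ξ ≤ majorant κ M₀ ξ := by
    conv_rhs => rw [majorant_eq hM₀]
    exact le_add_self
  have hw : weight ξ ≠ 0 := by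
    simp [weight, ENNReal.rpow_eq_top_iff, enorm_ne_top]
  have hκw : κ * weight ξ ≠ 0 := mul_ne_zero hκ hw
  have h2 : κ * weight ξ * lconv (majorant κ M₀) (majorant κ M₀) ξ < ∞ := lt_of_le_of_lt h1 hfin
  rcases ENNReal.mul_lt_top_iff.1 h2 with h | h | h
  · exact h.2
  · exact absurd h hκw
  · simp [h]

/-! ### Difference majorants: geometric convergence of the Picard scheme -/

/-- The difference majorants `E⁽⁰⁾ = E₀`, `E⁽ⁿ⁺¹⁾ = κ w · (E⁽ⁿ⁾ ⋆ M + M ⋆ E⁽ⁿ⁾)` dominating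
`t^{1/4} |v_{n+2} - v_{n+1}|` when `M` dominates all `t^{1/4}|v_n|` (bilinearity of the
Navier–Stokes nonlinearity; Lemarié-Rieusset, 2nd ed., §8.8, the inequalities for
`|U^{[n+1]} - U^{[n]}|`, PDF p. 208). [cite: Lemarierieusset2023, §8.8 (PDF p. 208)] -/
def diffIter (κ : ℝ≥0∞) (M E₀ : E → ℝ≥0∞) : ℕ → E → ℝ≥0∞
  | 0 => E₀
  | n + 1 => fun ξ => κ * weight ξ * (lconv (diffIter κ M E₀ n) M ξ + lconv M (diffIter κ M E₀ n) ξ)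

variable {M E₀ : E → ℝ≥0∞}

/-- The difference majorants are measurable. [folklore] -/
theorem measurable_diffIter (hM : Measurable M) (hE₀ : Measurable E₀) :
    ∀ n, Measurable (diffIter κ M E₀ n)
  | 0 => hE₀
  | n + 1 => (measurable_const.mul measurable_weight).mul
      ((measurable_lconv (measurable_diffIter hM hE₀ n) hM).add
        (measurable_lconv hM (measurable_diffIter hM hE₀ n)))

/-- **Geometric decay of the difference majorants**: if `2 κ K ‖M‖_F ≤ 1/2` then
`‖E⁽ⁿ⁾‖_F ≤ 2⁻ⁿ ‖E₀‖_F`. [cite: Lemarierieusset2023, §8.8 (PDF p. 208)] -/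
theorem fnorm_diffIter_le {K : ℝ≥0∞} (hK : HasProductLaw E K) (hM : Measurable M)
    (hE₀ : Measurable E₀) (hκ : κ ≠ ∞) (hcontr : 2 * κ * K * fnorm M ≤ 2⁻¹) :
    ∀ n, fnorm (diffIter κ M E₀ n) ≤ 2⁻¹ ^ n * fnorm E₀
  | 0 => by simp [diffIter]
  | n + 1 => by
    have ih := fnorm_diffIter_le hK hM hE₀ hκ hcontr n
    have hD := measurable_diffIter (κ := κ) hM hE₀ n
    set D := diffIter κ M E₀ n with hDdef
    have h1 : fnorm (diffIter κ M E₀ (n + 1)) =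
        κ * fnorm (fun ξ => weight ξ * lconv D M ξ + weight ξ * lconv M D ξ) := by
      rw [← fnorm_const_mul hκ]
      congr 1
      funext ξ
      simp only [diffIter, ← hDdef]
      ring
    rw [h1]
    calc κ * fnorm (fun ξ => weight ξ * lconv D M ξ + weight ξ * lconv M D ξ)
        ≤ κ * (fnorm (fun ξ => weight ξ * lconv D M ξ) + fnorm (fun ξ => weight ξ * lconv M D ξ)) := by
          gcongr
          exact fnorm_add_le (measurable_weight.mul (measurable_lconv hD hM))
            (measurable_weight.mul (measurable_lconv hM hD))
      _ ≤ κ * (K * fnorm D * fnorm M + K * fnorm M * fnorm D) := by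
          gcongr
          · exact fnorm_weight_mul_lconv_le hK hD hM
          · exact fnorm_weight_mul_lconv_le hK hM hD
      _ = (2 * κ * K * fnorm M) * fnorm D := by ring
      _ ≤ 2⁻¹ * (2⁻¹ ^ n * fnorm E₀) := mul_le_mul' hcontr ih
      _ = 2⁻¹ ^ (n + 1) * fnorm E₀ := by ring

/-- **Summability of the difference majorants**: `‖∑ₙ E⁽ⁿ⁾‖_F ≤ 2 ‖E₀‖_F`. [cite: Lemarierieusset2023, §8.8 (PDF p. 208)] -/
theorem fnorm_tsum_diffIter_le {K : ℝ≥0∞} (hK : HasProductLaw E K) (hM : Measurable M)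
    (hE₀ : Measurable E₀) (hκ : κ ≠ ∞) (hcontr : 2 * κ * K * fnorm M ≤ 2⁻¹) :
    fnorm (fun ξ => ∑' n, diffIter κ M E₀ n ξ) ≤ 2 * fnorm E₀ := by
  calc fnorm (fun ξ => ∑' n, diffIter κ M E₀ n ξ)
      ≤ ∑' n, fnorm (diffIter κ M E₀ n) := fnorm_tsum_le (measurable_diffIter hM hE₀)
    _ ≤ ∑' n : ℕ, 2⁻¹ ^ n * fnorm E₀ := ENNReal.tsum_le_tsum (fnorm_diffIter_le hK hM hE₀ hκ hcontr)
    _ = (∑' n : ℕ, (2⁻¹ : ℝ≥0∞) ^ n) * fnorm E₀ := ENNReal.tsum_mul_right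
    _ = 2 * fnorm E₀ := by
        rw [ENNReal.tsum_geometric, ENNReal.one_sub_inv_two, inv_inv]

/-! ### Almost-everywhere finiteness -/

/-- An envelope with finite `‖·‖_F` is finite almost everywhere (the weight `‖ξ‖²` vanishes only
at the origin, a null set in positive dimension). [folklore] -/
theorem ae_lt_top_of_fnorm_lt_top [Nontrivial E] {A : E → ℝ≥0∞} (hA : Measurable A)
    (h : fnorm A < ∞) : ∀ᵐ ξ ∂(volume : Measure E), A ξ < ∞ := by
  have h1 : ∫⁻ ξ, (‖ξ‖ₑ * A ξ) ^ (2 : ℝ) < ∞ := by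
    by_contra hc
    rw [not_lt, top_le_iff] at hc
    rw [fnorm, hc, ENNReal.top_rpow_of_pos (by norm_num)] at h
    exact lt_irrefl _ h
  have h2 : ∀ᵐ ξ ∂(volume : Measure E), (‖ξ‖ₑ * A ξ) ^ (2 : ℝ) < ∞ :=
    ae_lt_top' (f := fun ξ => (‖ξ‖ₑ * A ξ) ^ (2 : ℝ))
      ((measurable_id.enorm.mul hA).pow_const _).aemeasurable h1.ne
  have h0 : ∀ᵐ ξ ∂(volume : Measure E), ξ ≠ 0 := by
    have : ({(0 : E)} : Set E)ᶜ ∈ ae (volume : Measure E) :=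
      compl_mem_ae_iff.2 (measure_singleton (0 : E))
    filter_upwards [this] with ξ hξ
    simpa using hξ
  filter_upwards [h2, h0] with ξ hξ hξ0
  have hn : ‖ξ‖ₑ ≠ 0 := by simpa using hξ0
  by_contra hA'
  rw [not_lt, top_le_iff] at hA'
  rw [hA', ENNReal.mul_top hn, ENNReal.top_rpow_of_pos (by norm_num)] at hξ
  exact lt_irrefl _ hξ

end Literature.Analysis.FluidPDE.FujitaKato
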